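import Mathlib
import HarnessLib
import Summits.RiemannHypothesis.RiemannHypothesis.Theses.WeilParity
import Summits.RiemannHypothesis.RiemannHypothesis.Theorems.WeilParityEvenWinsBeyondArchSplit
import Summits.RiemannHypothesis.RiemannHypothesis.Theorems.WeilParityEvenWinsArch
import Summits.RiemannHypothesis.RiemannHypothesis.Theorems.WeilParityParityGlue
import Summits.RiemannHypothesis.RiemannHypothesis.Theorems.WeilParityEvenSectorWinsUpToLogThreeHalf
import Summits.RiemannHypothesis.RiemannHypothesis.Theorems.WeilParityOnePrimeWindowSimpleEven
import Literature.NumberTheory.LFunctions.UniformWeilPositivityRH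
import Literature.NumberTheory.LFunctions.WeilGroundEnergyParitySplit

/-!
# Crux `EvenWinsBeyondArch` (stmt-RiemannHypothesis-15432) — lead c2: audit of line `SketchIdeasK2`

Kernel-checked logical map of the ideation-cell line `SketchIdeasK2` (cards `Ideas/krein-gap-parity.md`,
`Ideas/division-moment-profile.md`; the cards quote the Sketch's definitions verbatim — the evidence file
itself, `run/gate/evidence/…/20260817T104847Z-SketchIdeasK2.lean`, is not mounted in the lead's jail).

Both cards transfer the crux to
* `C⁺ := ∀ a > (log 2)/2, WeilPositivityOn a` (the zero-sensitive input: a positive representing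
  "window pseudo-zero" measure `μ_a` exists iff the window form is positive), and
* an RH-free analytic half `PositivityToParity` (positive window form ⇒ even bottom ≤ odd bottom; to be
  obtained from Kreĭn's extension + a gapped-symbol parity schema, resp. the scale-free division identity +
  an odd moment-profile lemma).

This file proves:
* §1 `positivityBeyondArch_iff_riemannHypothesis` — `C⁺ ↔ RiemannHypothesis` (Yoshida/Weil criterion, in
  the tree unconditionally). So any skeleton of this line that concludes the crux BY NAME carries an
  RH-EQUIVALENT stub: the BC3 probe `stub → RiemannHypothesis` SUCCEEDS (term below), the line is not
  eligible for crux 15432 (costume of the summit) — exactly as both cards say themselves ("do not register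
  C⁺ as a stub of 15432; home = calibration item RHImpliesEvenWins, stmt-RiemannHypothesis-15436").
* §2 the K2 glue, re-derived: `PositivityToParity → C⁺ → EvenWinsBeyondArch`.
* §3 the honest home: `PositivityToParity → RHImpliesEvenWins` (route decl of item 15436), and under RH
  `PositivityToParity ↔ EvenWinsBeyondArch`.
* §4 the only BC3-eligible reshape inside the line — split by the SIGN of the window form,
  `EvenWinsBeyondArch ↔ PositivityToParity ∧ IndefiniteWindowsEvenWin` — and its collapse:
  `IndefiniteWindowsEvenWin` is implied by RH (vacuously) and carries no mechanism (under `¬RH` the cards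
  state "nothing orders the sectors"), so the reshape is `crux ⇐ RH ∧ (RH → crux)` in disguise.
* §5 RH-free status: `PositivityToParity` (indeed the order itself) holds on `(log 2)/2 < a ≤ (log 3)/2`
  unconditionally (landed one-prime window), and the standing residue `NoParityCrossing` (item 18085)
  implies both halves of the reshape.

Conclusion for the lead: line `SketchIdeasK2` is DEAD for crux 15432 (its transfer needs the summit as an
input; no repair inside the line); the crux stays blocked on item 18085; the two cards are lines for 15436.
-/

namespace Summit.RiemannHypothesis.RiemannHypothesis.Cruxes.EvenWinsBeyondArch.K2Audit

open Literature.NumberTheory.LFunctions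
open Summit.RiemannHypothesis.RiemannHypothesis.Theses.WeilParity
open Summit.RiemannHypothesis.RiemannHypothesis.Theorems
open Summit.RiemannHypothesis.RiemannHypothesis.Theorems.EvenWinsBeyondArch

/-! ## The line's two inputs, typed -/

/-- K2's transfer input `C⁺`: Weil positivity on every window beyond the archimedean one. -/
def PositivityBeyondArch : Prop :=
  ∀ a : ℝ, Real.log 2 / 2 < a → WeilPositivityOn a

/-- K2's RH-free analytic half (`PositivityToParity` of the Sketch, ground-energy form): a positive window
form has its even bottom below its odd bottom. -/
def PositivityToParity : Prop :=
  ∀ a : ℝ, Real.log 2 / 2 < a → WeilPositivityOn a → weilEvenGroundEnergy a ≤ weilOddGroundEnergy a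

/-- The complementary half of the sign split (§4): on windows where the form is INDEFINITE the even
sector still wins. No card offers a mechanism for it. -/
def IndefiniteWindowsEvenWin : Prop :=
  ∀ a : ℝ, Real.log 2 / 2 < a → ¬ WeilPositivityOn a → weilEvenGroundEnergy a ≤ weilOddGroundEnergy a

/-! ## §1 The costume certificate: `C⁺ ↔ RH` -/

/-- `log 2 / 2 < 1`. -/
theorem log_two_half_lt_one : Real.log 2 / 2 < 1 := by
  have h : Real.log 2 < 1 := by
    have := Real.log_two_lt_d9
    linarith
  linarith

/-- Positivity beyond the archimedean window is positivity on every window (antitonicity in `a`). -/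
theorem positivityBeyondArch_iff_forall_pos :
    PositivityBeyondArch ↔ ∀ a : ℝ, 0 < a → WeilPositivityOn a := by
  refine ⟨fun h a _ ↦ ?_, fun h a ha ↦ h a (log_two_half_pos.trans ha)⟩
  have hb : Real.log 2 / 2 < a + 1 := by
    have := log_two_half_lt_one
    linarith
  exact WeilPositivityOn.mono (by linarith) (h (a + 1) hb)

/-- **BC3 probe, succeeding**: K2's transfer input `C⁺` is EQUIVALENT to the Riemann hypothesis
(`riemannHypothesis_iff_forall_weilPositivityOn`, Yoshida/Weil, unconditional in the tree). -/
theorem positivityBeyondArch_iff_riemannHypothesis : PositivityBeyondArch ↔ RiemannHypothesis :=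
  positivityBeyondArch_iff_forall_pos.trans riemannHypothesis_iff_forall_weilPositivityOn.symm

/-- The probe in the exact shape a skeleton vet runs it: the would-be stub proves the summit. -/
theorem riemannHypothesis_of_stub_positivityBeyondArch
    (stub_positivityBeyondArch : ∀ a : ℝ, Real.log 2 / 2 < a → WeilPositivityOn a) :
    RiemannHypothesis :=
  positivityBeyondArch_iff_riemannHypothesis.1 stub_positivityBeyondArch

/-! ## §2 The K2 glue, re-derived -/

/-- K2 glue (`evenWinsBeyondArch_of_positivityToParity` of the Sketch): the analytic half and `C⁺` give
the crux by name (via the landed `evenWinsBeyondArch_iff_forall_le`). -/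
theorem evenWinsBeyondArch_of_positivityToParity (hT : PositivityToParity)
    (hP : PositivityBeyondArch) : EvenWinsBeyondArch :=
  evenWinsBeyondArch_iff_forall_le.2 fun a ha ↦ hT a ha (hP a ha)

/-- The same with the input named honestly: `PositivityToParity → RH → EvenWinsBeyondArch`. -/
theorem evenWinsBeyondArch_of_positivityToParity_of_riemannHypothesis (hT : PositivityToParity)
    (hRH : RiemannHypothesis) : EvenWinsBeyondArch :=
  evenWinsBeyondArch_of_positivityToParity hT (positivityBeyondArch_iff_riemannHypothesis.2 hRH)

/-! ## §3 The honest home of the line: the calibration item `RHImpliesEvenWins` (15436) -/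

/-- **K2 is a line for item 15436**: the analytic half alone proves the route decl
`RHImpliesEvenWins` (with the CLOSED `EvenWinsArch` and `ParityGlue`). -/
theorem rhImpliesEvenWins_of_positivityToParity (hT : PositivityToParity) : RHImpliesEvenWins :=
  fun hRH ↦ WeilParity.parityGlue_proof WeilParity.evenWinsArch_proof
    (evenWinsBeyondArch_of_positivityToParity_of_riemannHypothesis hT hRH)

/-- Under RH the analytic half IS the crux (Connes' order hypothesis beyond the archimedean window). -/
theorem positivityToParity_iff_evenWinsBeyondArch_of_riemannHypothesis (hRH : RiemannHypothesis) :
    PositivityToParity ↔ EvenWinsBeyondArch := by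
  refine ⟨fun hT ↦ evenWinsBeyondArch_of_positivityToParity_of_riemannHypothesis hT hRH, fun h a ha _ ↦ ?_⟩
  exact evenWinsBeyondArch_iff_forall_le.1 h a ha

/-- Conversely the crux implies the analytic half outright (drop the positivity hypothesis). -/
theorem positivityToParity_of_evenWinsBeyondArch (h : EvenWinsBeyondArch) : PositivityToParity :=
  fun a ha _ ↦ evenWinsBeyondArch_iff_forall_le.1 h a ha

/-! ## §4 The only BC3-eligible reshape inside the line, and its collapse -/

/-- Sign split: the crux is EQUIVALENT to (analytic half on definite windows) ∧ (even wins on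
indefinite windows). -/
theorem evenWinsBeyondArch_iff_positivityToParity_and_indefinite :
    EvenWinsBeyondArch ↔ PositivityToParity ∧ IndefiniteWindowsEvenWin := by
  refine ⟨fun h ↦ ⟨positivityToParity_of_evenWinsBeyondArch h, fun a ha _ ↦
    evenWinsBeyondArch_iff_forall_le.1 h a ha⟩, fun ⟨hT, hI⟩ ↦ ?_⟩
  refine evenWinsBeyondArch_iff_forall_le.2 fun a ha ↦ ?_
  by_cases hP : WeilPositivityOn a
  · exact hT a ha hP
  · exact hI a ha hP

/-- The indefinite half is implied by RH VACUOUSLY (no window is indefinite under RH): it is pure RH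
content with no mechanism, i.e. the RH residue renamed. -/
theorem indefiniteWindowsEvenWin_of_riemannHypothesis (hRH : RiemannHypothesis) :
    IndefiniteWindowsEvenWin :=
  fun a ha hP ↦ (hP (positivityBeyondArch_iff_riemannHypothesis.2 hRH a ha)).elim

/-- … and the whole reshape is `crux ⇐ RH ∧ (RH → thesis)`: the crux from RH and the calibration
item, one line — what every positivity-conditioned line for 15432 factors through. -/
theorem evenWinsBeyondArch_of_riemannHypothesis_of_calibration (hRH : RiemannHypothesis)
    (hCal : RHImpliesEvenWins) : EvenWinsBeyondArch :=
  fun a ha ↦ hCal hRH a (log_two_half_pos.trans ha)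

/-! ## §5 RH-free status of the two halves -/

/-- The analytic half — indeed the order itself, with no positivity hypothesis — HOLDS on the one-prime
window `(log 2)/2 < a ≤ (log 3)/2` (landed, RH-free). Beyond `(log 3)/2` positivity itself is not known
RH-free in the tree (`weilPositivityOn_log_three_half` is the largest certified window), so the line has no
RH-free content for this crux beyond what is already landed. -/
theorem positivityToParity_upTo_logThreeHalf {a : ℝ} (ha : Real.log 2 / 2 < a)
    (hle : a ≤ Real.log 3 / 2) : weilEvenGroundEnergy a ≤ weilOddGroundEnergy a :=
  WeilParity.weilEvenGroundEnergy_le_weilOddGroundEnergy_of_le_logThreeHalf (log_two_half_pos.trans ha) hle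

/-- The standing residue implies both halves of the reshape (via the landed split glue and the CLOSED
one-prime window): the K2 reshape is not finer than line `split`'s cut. -/
theorem positivityToParity_and_indefinite_of_noParityCrossing (h : NoParityCrossing) :
    PositivityToParity ∧ IndefiniteWindowsEvenWin :=
  evenWinsBeyondArch_iff_positivityToParity_and_indefinite.1
    (evenWinsBeyondArch_of_subs WeilParity.onePrimeWindowSimpleEven_proof h)

end Summit.RiemannHypothesis.RiemannHypothesis.Cruxes.EvenWinsBeyondArch.K2Audit
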